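import Summits.AnomalousDissipation.AnomalousDissipation.Theorems.BaireTransferRobustLoudUpgradeStubLsSaddlePeriodicA
import Literature.Analysis.FluidPDE.TimePeriodicNSLatticeLinearToLattice

/-!
# Stub `stub_lsSaddlePeriodic` (crux stmt-AnomalousDissipation-1144, companion c3), part B: CLASSICAL → LATTICE transfer for the invisible
# saddle of cycles (`vec_eq_of_classical` on `TimePeriodicLattice.linear_lattice_of_classical`; `response_vec`; `saddle_transfer`; registered
# abstract ending `lsSaddlePeriodic_partB`).  Pure proof file; notations verbatim from `PeriodicNSOrbitPersistsProofs`.  Refs: Kielhöfer 2012 §I.16.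
-/


-- `Summit.<Summit>.<Problem>` is the tree's mandated summit-side namespace (CONVENTIONS §2); for this
-- single-conjunct summit the two coincide, so the duplicate is deliberate.
set_option linter.dupNamespace false

noncomputable section

open scoped BigOperators Topology ENNReal NNReal ComplexConjugate
open Filter Set Function MeasureTheory UnitAddTorus

namespace Summit.AnomalousDissipation.AnomalousDissipation.Theorems.RobustLoudUpgrade.LsFamilyPeriodic

open Literature.Analysis.FunctionSpaces Literature.Analysis.FunctionSpaces.Torus
open Literature.Analysis.FunctionSpaces.EuclideanSpace
open Literature.Analysis.FluidPDE
open Literature.Analysis.FluidPDE.ScalarFourier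
open Literature.Analysis.FluidPDE.TimePeriodicLattice
open Summit.AnomalousDissipation.AnomalousDissipation.Theses.BaireTransfer

-- NOTATION START (verbatim from `PeriodicNSOrbitPersistsProofs`)
/-- Local notation: the parabolic weight `Λ(n, k) = |n| + |k|²`. -/
local notation:max "Λ" m:max => (|((Prod.fst m : ℤ) : ℝ)| + freqNormSq (Prod.snd m))

/-- Local notation: the convective symbol on `ℤ × ℤ³` (as in `TimePeriodicNSLattice`). -/
local notation:max "𝐍[" a ", " b "]" m:max =>
  (WithLp.toLp 2 (fun p : Fin 3 => ∑ j : Fin 3, ∑' m' : ℤ × (Fin 3 → ℤ),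
    a m' j * (dsym j (Prod.snd m - Prod.snd m') * b (m - m') p)) : EuclideanSpace ℂ (Fin 3))

/-- Local notation: division by the weight. -/
local notation:max "𝐜" x:max => (fun mm : ℤ × (Fin 3 → ℤ) =>
  ((((|((Prod.fst mm : ℤ) : ℝ)| + freqNormSq (Prod.snd mm))⁻¹ : ℝ) : ℂ) • x mm))

/-- Local notation: multiplication by the weight. -/
local notation:max "𝐬" x:max => (fun mm : ℤ × (Fin 3 → ℤ) =>
  ((((|((Prod.fst mm : ℤ) : ℝ)| + freqNormSq (Prod.snd mm)) : ℝ) : ℂ) • x mm))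

/-- Local notation: the family of coefficients of `x ∈ W ⊂ ℓ²`. -/
local notation:max "𝐰" x:max =>
  (((x : lp (fun _ : ℤ × (Fin 3 → ℤ) => EuclideanSpace ℂ (Fin 3)) 2)) : ℤ × (Fin 3 → ℤ) → EuclideanSpace ℂ (Fin 3))

/-- Local notation: the extension `K ↦ c (K₀, tail K)` of a lattice family to `ℤ⁴`. -/
local notation:max "𝐄" c:max => (fun K : Fin 4 → ℤ => c ((K 0, Fin.tail K) : ℤ × (Fin 3 → ℤ)))

/-- Local notation: the lattice family `û(n,k) = 𝓕(complexify ∘ (U − m₀))(n,k)`. -/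
local notation:max "𝐮[" U ", " m₀ "]" => (fun mm : ℤ × (Fin 3 → ℤ) =>
  mFourierCoeff (EuclideanSpace.complexify ∘ fun y : UnitAddTorus (Fin 4) => U y - m₀)
    (Fin.cons (Prod.fst mm) (Prod.snd mm) : Fin 4 → ℤ))

/-- Local notation: the force family `y_F(n,k) = [k ≠ 0][n = 0] 𝓕(complexify ∘ F)(k)`. -/
local notation:max "𝐲" F:max => (fun mm : ℤ × (Fin 3 → ℤ) =>
  (ite (Prod.snd mm = 0) (0 : EuclideanSpace ℂ (Fin 3))
    (ite (Prod.fst mm = 0) (mFourierCoeff (EuclideanSpace.complexify ∘ F) (Prod.snd mm)) 0)))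

/-- Local notation: the lattice family of the orbit `u` with period `τ`. -/
local notation:max "𝐨[" τ ", " u "]" => (fun mm : ℤ × (Fin 3 → ℤ) =>
  mFourierCoeff (EuclideanSpace.complexify ∘ fun y : UnitAddTorus (Fin 4) => Torus.timeRoll τ u y - ∫ x, u 0 x)
    (Fin.cons (Prod.fst mm) (Prod.snd mm) : Fin 4 → ℤ))
/-- Local notation: the time multiplier `dₛ(n,k) = 2πi n / Λ(n,k)`. -/
local notation "dS" => (fun mm : ℤ × (Fin 3 → ℤ) =>
  (2 * Real.pi * Complex.I * ((Prod.fst mm : ℤ) : ℂ)) * ((((|((Prod.fst mm : ℤ) : ℝ)| + freqNormSq (Prod.snd mm)) : ℝ) : ℂ))⁻¹)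

/-- Local notation: the Stokes–drift multiplier `(4π²ν|k|² + 2πi m₀·k) / Λ(n,k)`. -/
local notation "dL[" ν ", " m₀ "]" => (fun mm : ℤ × (Fin 3 → ℤ) =>
  (((4 * Real.pi ^ 2 * ν * freqNormSq (Prod.snd mm) : ℝ) : ℂ) +
      2 * Real.pi * Complex.I * (∑ jj : Fin 3, ((m₀ jj : ℝ) : ℂ) * (((Prod.snd mm) jj : ℤ) : ℂ))) *
    ((((|((Prod.fst mm : ℤ) : ℝ)| + freqNormSq (Prod.snd mm)) : ℝ) : ℂ))⁻¹)

/-- Local notation: the symbol `σ_om(n,k) = 2πiomn + 4π²ν|k|² + 2πi m₀·k`. -/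
local notation "σ[" om ", " ν ", " m₀ "]" => (fun mm : ℤ × (Fin 3 → ℤ) =>
  2 * Real.pi * Complex.I * ((om : ℝ) : ℂ) * ((Prod.fst mm : ℤ) : ℂ) +
    (((4 * Real.pi ^ 2 * ν * freqNormSq (Prod.snd mm) : ℝ)) : ℂ) +
    2 * Real.pi * Complex.I * (∑ jj : Fin 3, ((m₀ jj : ℝ) : ℂ) * (((Prod.snd mm) jj : ℤ) : ℂ)))
-- NOTATION END

variable {W : Submodule ℝ (lp (fun _ : ℤ × (Fin 3 → ℤ) => EuclideanSpace ℂ (Fin 3)) 2)}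

/-! ## §1 Classical → lattice: a classical linearised solution is a lattice solution -/

section Transfer

variable {ν τ : ℝ} {f : UnitAddTorus (Fin 3) → EuclideanSpace ℝ (Fin 3)}
  {u : ℝ → UnitAddTorus (Fin 3) → EuclideanSpace ℝ (Fin 3)} {p : ℝ → UnitAddTorus (Fin 3) → ℝ}

variable (hW : ∀ x : lp (fun _ : ℤ × (Fin 3 → ℤ) => EuclideanSpace ℂ (Fin 3)) 2, x ∈ W ↔
      (∀ n : ℤ, (x : ℤ × (Fin 3 → ℤ) → EuclideanSpace ℂ (Fin 3)) (n, 0) = 0) ∧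
      (∀ mm : ℤ × (Fin 3 → ℤ), (∑ jj : Fin 3, ((mm.2 jj : ℤ) : ℂ) *
        ((x : ℤ × (Fin 3 → ℤ) → EuclideanSpace ℂ (Fin 3)) mm) jj) = 0) ∧
      (∀ mm : ℤ × (Fin 3 → ℤ), (x : ℤ × (Fin 3 → ℤ) → EuclideanSpace ℂ (Fin 3)) (-mm) =
        conjVec ((x : ℤ × (Fin 3 → ℤ) → EuclideanSpace ℂ (Fin 3)) mm)))
variable {Ds L₀ : W →L[ℝ] W} (hDs : ∀ (x : W) (m : ℤ × (Fin 3 → ℤ)), (𝐰 (Ds x)) m = dS m • (𝐰 x) m)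
  (hL₀ : ∀ (x : W) (m : ℤ × (Fin 3 → ℤ)), (𝐰 (L₀ x)) m = dL[ν, ∫ x, u 0 x] m • (𝐰 x) m)
variable {B : W → W → W} (hBf : ∀ (x y : W) (m : ℤ × (Fin 3 → ℤ)), (𝐰 (B x y)) m = Torus.lerayCoeff m.2 (𝐍[𝐜 (𝐰 x), 𝐜 (𝐰 y)] m))

include hW hDs hL₀ hBf in
/-- **A real classical solution of the linearised periodic problem, forced by the unrolling of a smooth `Gc` on `T⁴`, is a lattice solution**
`T kp = Y` for any `Y ∈ W` with the Leray-projected coefficients of `Gc` off the zero modes (`linear_lattice_of_classical` + `coord_lin`). [folklore] -/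
theorem vec_eq_of_classical (hτ : 0 < τ) (hsol : Torus.IsClassicalNSSolutionOn univ ν (fun _ => f) u p)
    (hper : Function.Periodic u τ) (hf0 : HasZeroMean f) (x₀ : W) (hx₀ : 𝐰 x₀ = 𝐬 (𝐨[τ, u]))
    {wp : ℝ → UnitAddTorus (Fin 3) → EuclideanSpace ℝ (Fin 3)} (hswp : IsSmoothSpaceTimeOn univ wp) (hwpper : Function.Periodic wp τ)
    (hwpdiv : ∀ t, IsDivFree (wp t)) (hwp0 : ∀ t, HasZeroMean (wp t))
    {Gc : UnitAddTorus (Fin 4) → EuclideanSpace ℂ (Fin 3)} (hGc : IsSmooth Gc)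
    (hmem : (fun t x => Torus.realToComplex (wp t x)) ∈
      linPeriodicSol ν u τ (fun t x => Gc (Fin.cons (((τ⁻¹ * t : ℝ)) : UnitAddCircle) x)))
    (Y : W) (hY : ∀ m : ℤ × (Fin 3 → ℤ), m.2 ≠ 0 → (𝐰 Y) m = Torus.lerayCoeff m.2 (mFourierCoeff Gc (Fin.cons m.1 m.2))) :
    ∃ kp : W, 𝐰 kp = 𝐬 (𝐮[timeRoll τ wp, 0]) ∧ τ⁻¹ • Ds kp + L₀ kp + (B x₀ kp + B kp x₀) = Y := by
  have hu0 := orbit_zero_modes hsol hper hf0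
  have hcx₀ : 𝐜 (𝐰 x₀) = 𝐨[τ, u] := by rw [hx₀]; exact cw_sw (x := 𝐨[τ, u]) hu0
  obtain ⟨kp, hkp⟩ := exists_fieldVecW hW hswp hwpper hwpdiv hwp0
  obtain ⟨hwz, -, -, -⟩ := fieldFamily_admissible (τ := τ) (Z := wp) hswp hwpper hwpdiv hwp0
  have hckp : 𝐜 (𝐰 kp) = 𝐮[timeRoll τ wp, 0] := by rw [hkp]; exact cw_sw (x := 𝐮[timeRoll τ wp, 0]) hwz
  obtain ⟨hsw, hdivC, -, hperw, q, hsq, heq⟩ := hmem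
  have hτi : τ⁻¹ ≠ 0 := inv_ne_zero hτ.ne'
  have hgs : IsSmoothSpaceTimeOn univ (fun t : ℝ => fun x : UnitAddTorus (Fin 3) => Gc (Fin.cons (((τ⁻¹ * t : ℝ)) : UnitAddCircle) x)) :=
    isSmoothSpaceTimeOn_cons hGc τ⁻¹
  have hgper : Function.Periodic (fun t : ℝ => fun x : UnitAddTorus (Fin 3) => Gc (Fin.cons (((τ⁻¹ * t : ℝ)) : UnitAddCircle) x)) τ := by
    have := periodic_comp_cons Gc hτi
    rwa [inv_inv] at this
  have hrollG : timeRoll τ (fun t : ℝ => fun x : UnitAddTorus (Fin 3) => Gc (Fin.cons (((τ⁻¹ * t : ℝ)) : UnitAddCircle) x)) = Gc := by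
    have := timeRoll_comp_cons Gc hτi
    rwa [inv_inv] at this
  have hrollw : timeRoll τ (fun t x => Torus.realToComplex (wp t x)) = complexify ∘ fun y => timeRoll τ wp y - 0 := by
    funext y
    simp only [timeRoll, Function.comp_apply, sub_zero, SteadyLattice.realToComplex_eq_complexify]
  have hlat := fun m hm => linear_lattice_of_classical hτ hsol hper hsw hperw hsq hgs hgper heq hdivC m hm
  refine ⟨kp, hkp, W_ext fun m => ?_⟩
  by_cases hm : m.2 = 0
  · rw [W_zero' hW _ hm, W_zero' hW _ hm]
  · rw [coord_lin hDs hL₀ hBf kp x₀ τ⁻¹ m, hckp, hcx₀, hY m hm]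
    have h1 := hlat m hm
    rw [hrollG, hrollw] at h1
    exact h1

include hW hDs hL₀ hBf in
/-- **The lattice response of an INVISIBLE force direction**: a real admissible classical solution of the problem forced by `βd ∂ₜu + f_d`
has a weighted coefficient vector solving `T kd = (βd τ⁻¹) ∂ₛx₀ + Y_{f_d}`. [folklore] -/
theorem response_vec {S : Finset (Fin 3 → ℤ)} (hτ : 0 < τ) (hsol : Torus.IsClassicalNSSolutionOn univ ν (fun _ => f) u p)
    (hper : Function.Periodic u τ) (hf0 : HasZeroMean f) (x₀ : W) (hx₀ : 𝐰 x₀ = 𝐬 (𝐨[τ, u]))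
    (Fm : Coeff S →L[ℝ] W) (hFm : ∀ c : Coeff S, 𝐰 (Fm c) = 𝐲 (force S c)) (d : Coeff S) (βd : ℝ)
    {wd : ℝ → UnitAddTorus (Fin 3) → EuclideanSpace ℝ (Fin 3)} (hswd : IsSmoothSpaceTimeOn univ wd) (hwdper : Function.Periodic wd τ)
    (hwddiv : ∀ t, IsDivFree (wd t)) (hwd0 : ∀ t, HasZeroMean (wd t))
    (hmem : (fun t x => Torus.realToComplex (wd t x)) ∈
      linPeriodicSol ν u τ (fun t x => (βd : ℂ) • velocityDot u t x + cplx (force S d) x)) :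
    ∃ kd : W, τ⁻¹ • Ds kd + L₀ kd + (B x₀ kd + B kd x₀) = (βd * τ⁻¹) • Ds x₀ + Fm d := by
  have hU : IsSmooth (timeRoll τ u) := orbit_isSmooth hsol hper
  have hut := orbit_transversal hsol hper
  have hF : IsSmooth (force S d) := SteadyPersist.isSmooth_force' d
  have hFc : IsSmooth (complexify ∘ force S d) := hF.comp_clm complexify.toContinuousLinearMap
  have hdU : IsSmooth (complexify ∘ Torus.partialDeriv 0 (timeRoll τ u)) := (hU.partialDeriv 0).comp_clm complexify.toContinuousLinearMap
  set Gc : UnitAddTorus (Fin 4) → EuclideanSpace ℂ (Fin 3) := fun y =>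
    ((βd : ℂ) * ((τ⁻¹ : ℝ) : ℂ)) • (complexify ∘ Torus.partialDeriv 0 (timeRoll τ u)) y + (complexify ∘ force S d) (Fin.tail y) with hGc
  have hGt : IsSmooth (fun y : UnitAddTorus (Fin 4) => (complexify ∘ force S d) (Fin.tail y)) := by
    have h1 := isSmooth_timeRoll (τ := 1) (isSmoothSpaceTimeOn_const hFc univ) (fun _ => rfl)
    have e : timeRoll 1 (fun _ : ℝ => complexify ∘ force S d) = fun y : UnitAddTorus (Fin 4) => (complexify ∘ force S d) (Fin.tail y) := by
      funext y; simp [timeRoll]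
    rw [e] at h1
    exact h1
  have hGcs : IsSmooth Gc := (isSmooth_smul_complex (isSmooth_const _) hdU).add hGt
  have hfun : (fun t x => (βd : ℂ) • velocityDot u t x + cplx (force S d) x) =
      fun t : ℝ => fun x : UnitAddTorus (Fin 3) => Gc (Fin.cons (((τ⁻¹ * t : ℝ)) : UnitAddCircle) x) := by
    funext t x
    have hs : τ * (τ⁻¹ * t) = t := by field_simp
    have h0 := partialDeriv_zero_timeRoll hsol.smooth_velocity hper (τ⁻¹ * t) x
    rw [hs] at h0
    simp only [hGc, Function.comp_apply, Fin.tail_cons, h0, LinearIsometry.map_smul, velocityDot, cplx,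
      SteadyLattice.realToComplex_eq_complexify]
    rw [← Complex.coe_smul τ, smul_smul, mul_assoc, ← Complex.ofReal_mul, inv_mul_cancel₀ hτ.ne', Complex.ofReal_one, mul_one]
  rw [hfun] at hmem
  have hY : ∀ m : ℤ × (Fin 3 → ℤ), m.2 ≠ 0 →
      (𝐰 (((βd * τ⁻¹) • Ds x₀ + Fm d : W))) m = Torus.lerayCoeff m.2 (mFourierCoeff Gc (Fin.cons m.1 m.2)) := by
    intro m hm
    have hint1 : Integrable (fun y : UnitAddTorus (Fin 4) => ((βd : ℂ) * ((τ⁻¹ : ℝ) : ℂ)) • (complexify ∘ Torus.partialDeriv 0 (timeRoll τ u)) y) volume :=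
      (isSmooth_smul_complex (isSmooth_const _) hdU).continuous.integrable_unitAddTorus
    have hint2 : Integrable (fun y : UnitAddTorus (Fin 4) => (complexify ∘ force S d) (Fin.tail y)) volume := hGt.continuous.integrable_unitAddTorus
    have e1 : mFourierCoeff Gc (Fin.cons m.1 m.2) = ((βd : ℂ) * ((τ⁻¹ : ℝ) : ℂ)) • ((2 * Real.pi * Complex.I * (m.1 : ℂ)) • 𝐨[τ, u] m) +
        (𝐲 (force S d)) m := by
      have e2 : Gc = (fun y => ((βd : ℂ) * ((τ⁻¹ : ℝ) : ℂ)) • (complexify ∘ Torus.partialDeriv 0 (timeRoll τ u)) y) +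
          fun y : UnitAddTorus (Fin 4) => (complexify ∘ force S d) (Fin.tail y) := by funext y; simp [hGc]
      rw [e2, mFourierCoeff_add hint1 hint2, show (fun y => ((βd : ℂ) * ((τ⁻¹ : ℝ) : ℂ)) • (complexify ∘ Torus.partialDeriv 0 (timeRoll τ u)) y) =
        ((βd : ℂ) * ((τ⁻¹ : ℝ) : ℂ)) • (complexify ∘ Torus.partialDeriv 0 (timeRoll τ u)) from rfl, mFourierCoeff_const_smul,
        coeff_partialDeriv_zero hU m, mFourierCoeff_comp_tail hFc.continuous m.1 m.2, yf_of_snd_ne_zero (force S d) hm]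
    rw [e1, SteadyLattice.lerayCoeff_add', coeW_add, Pi.add_apply, coe_smul_Ds_orbit hDs hsol hper hf0 x₀ hx₀ (βd * τ⁻¹) m, hFm,
      SteadyLattice.lerayCoeff_of_kdot_eq_zero hm (by
        rw [SteadyLattice.kdot_smul, SteadyLattice.kdot_smul, hut m, mul_zero, mul_zero] :
        (∑ jj : Fin 3, ((m.2 jj : ℤ) : ℂ) * ((((βd : ℂ) * ((τ⁻¹ : ℝ) : ℂ)) • ((2 * Real.pi * Complex.I * (m.1 : ℂ)) • 𝐨[τ, u] m)) jj)) = 0),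
      SteadyLattice.lerayCoeff_of_kdot_eq_zero hm (yf_transversal hF (SteadyPersist.isDivFree_force' d) m), Complex.ofReal_mul]
  obtain ⟨kd, -, hkd⟩ := vec_eq_of_classical hW hDs hL₀ hBf hτ hsol hper hf0 x₀ hx₀ hswd hwdper hwddiv hwd0 hGcs hmem _ hY
  exact ⟨kd, hkd⟩

set_option maxHeartbeats 1600000 in
include hW hDs hL₀ hBf in
/-- **Second-order solvability data on the lattice** (converse transport of `fold_transfer`): for a response pair `(ke, μe)` and a kernel pair
`(kr, μr)` realised classically as `we`, `wr`, a real admissible classical solution of the problem forced by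
`βp ∂ₜu + [(Z·∇)Z − ((−μeτ) + l(−μrτ)) ∂ₜZ] + α H`, `Z = we + l wr`, gives `T kp = (βp τ⁻¹) ∂ₛx₀ + [(μe + l μr) ∂ₛkZ + B(kZ,kZ)] + α Y_H`. [folklore] -/
theorem saddle_transfer (hν : 0 < ν) (hτ : 0 < τ) (hsol : Torus.IsClassicalNSSolutionOn univ ν (fun _ => f) u p)
    (hper : Function.Periodic u τ) (hf0 : HasZeroMean f) (x₀ : W) (hx₀ : 𝐰 x₀ = 𝐬 (𝐨[τ, u]))
    {H : ℝ → UnitAddTorus (Fin 3) → EuclideanSpace ℝ (Fin 3)} (hH : IsSmoothSpaceTimeOn univ H) (hHper : Function.Periodic H τ)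
    (hHdiv : ∀ t, IsDivFree (H t)) (hH0 : ∀ t, HasZeroMean (H t)) (YH : W) (hYH : 𝐰 YH = 𝐮[timeRoll τ H, 0])
    {D : ℝ → UnitAddTorus (Fin 3) → EuclideanSpace ℝ (Fin 3)} (hD : IsSmoothSpaceTimeOn univ D) (hDper : Function.Periodic D τ)
    (hDdiv : ∀ t, IsDivFree (D t)) (hD0 : ∀ t, HasZeroMean (D t)) (YD : W) (hYD : 𝐰 YD = 𝐮[timeRoll τ D, 0])
    (ke : W) (μe : ℝ) (heqe : τ⁻¹ • Ds ke + L₀ ke + (B x₀ ke + B ke x₀) = (-μe) • Ds x₀ + YD)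
    (kr : W) (μr : ℝ) (heqr : τ⁻¹ • Ds kr + L₀ kr + (B x₀ kr + B kr x₀) = (-μr) • Ds x₀)
    (l α βp : ℝ) {wp : ℝ → UnitAddTorus (Fin 3) → EuclideanSpace ℝ (Fin 3)} (hswp : IsSmoothSpaceTimeOn univ wp)
    (hwpper : Function.Periodic wp τ) (hwpdiv : ∀ t, IsDivFree (wp t)) (hwp0 : ∀ t, HasZeroMean (wp t))
    (hmem : (fun t x => Torus.realToComplex (wp t x)) ∈ linPeriodicSol ν u τ (fun t x => (βp : ℂ) • velocityDot u t x +
      Torus.realToComplex (Torus.convect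
        (fun y => EuclideanSpace.realPart (fourierSynth (𝐄 (𝐜 (𝐰 ke))) (Fin.cons (((τ⁻¹ * t : ℝ)) : UnitAddCircle) y)) +
          l • EuclideanSpace.realPart (fourierSynth (𝐄 (𝐜 (𝐰 kr))) (Fin.cons (((τ⁻¹ * t : ℝ)) : UnitAddCircle) y)))
        (fun y => EuclideanSpace.realPart (fourierSynth (𝐄 (𝐜 (𝐰 ke))) (Fin.cons (((τ⁻¹ * t : ℝ)) : UnitAddCircle) y)) +
          l • EuclideanSpace.realPart (fourierSynth (𝐄 (𝐜 (𝐰 kr))) (Fin.cons (((τ⁻¹ * t : ℝ)) : UnitAddCircle) y))) x -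
        ((-μe) * τ + l * ((-μr) * τ)) • Torus.timeDerivWithin univ (fun s y =>
          EuclideanSpace.realPart (fourierSynth (𝐄 (𝐜 (𝐰 ke))) (Fin.cons (((τ⁻¹ * s : ℝ)) : UnitAddCircle) y)) +
          l • EuclideanSpace.realPart (fourierSynth (𝐄 (𝐜 (𝐰 kr))) (Fin.cons (((τ⁻¹ * s : ℝ)) : UnitAddCircle) y))) t x +
        α • H t x))) :
    ∃ kp : W, τ⁻¹ • Ds kp + L₀ kp + (B x₀ kp + B kp x₀) =
      (βp * τ⁻¹) • Ds x₀ + ((μe + l * μr) • Ds (ke + l • kr) + B (ke + l • kr) (ke + l • kr)) + α • YH := by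
  have hU : IsSmooth (timeRoll τ u) := orbit_isSmooth hsol hper
  have hut := orbit_transversal hsol hper
  have hτi : τ⁻¹ ≠ 0 := inv_ne_zero hτ.ne'
  -- §a the two realised fields and their combination on `T⁴`
  obtain ⟨hre, hWes, hreale, hcoefe, -, -, -⟩ := responseField hW hDs hL₀ hBf hν hτ hsol hper hf0 x₀ hx₀ hD hDper hDdiv hD0 YD hYD ke μe heqe
  obtain ⟨hrr, hWrs, hrealr, hcoefr, -, -, -⟩ := kernelField hW hDs hL₀ hBf hν hτ hsol hper hf0 x₀ hx₀ kr μr heqr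
  set We : UnitAddTorus (Fin 4) → EuclideanSpace ℝ (Fin 3) := fun y => EuclideanSpace.realPart (fourierSynth (𝐄 (𝐜 (𝐰 ke))) y) with hWe
  set Wr : UnitAddTorus (Fin 4) → EuclideanSpace ℝ (Fin 3) := fun y => EuclideanSpace.realPart (fourierSynth (𝐄 (𝐜 (𝐰 kr))) y) with hWr
  set WZ : UnitAddTorus (Fin 4) → EuclideanSpace ℝ (Fin 3) := fun y => We y + l • Wr y with hWZ
  set kZ : W := ke + l • kr with hkZ
  have hWZs : IsSmooth WZ := hWes.add (hWrs.smul l)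
  set Z : ℝ → UnitAddTorus (Fin 3) → EuclideanSpace ℝ (Fin 3) := fun t x => WZ (Fin.cons (((τ⁻¹ * t : ℝ)) : UnitAddCircle) x) with hZ
  have hzs : IsSmoothSpaceTimeOn univ Z := isSmoothSpaceTimeOn_cons hWZs τ⁻¹
  have hzper : Function.Periodic Z τ := by have := periodic_comp_cons WZ hτi; rwa [inv_inv] at this
  have hroll : timeRoll τ Z = WZ := by have := timeRoll_comp_cons WZ hτi; rwa [inv_inv] at this
  have hcZ : ∀ m : ℤ × (Fin 3 → ℤ), (𝐜 (𝐰 kZ)) m = (𝐜 (𝐰 ke)) m + (l : ℂ) • (𝐜 (𝐰 kr)) m := by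
    intro m
    simp only [hkZ, coeW_add, coeW_smul, Pi.add_apply, Pi.smul_apply, smul_add, ← Complex.coe_smul l, smul_comm ((l : ℝ) : ℂ)]
  have hIe : Integrable (complexify ∘ We) volume := (hWes.comp_clm complexify.toContinuousLinearMap).continuous.integrable_unitAddTorus
  have hIr : Integrable (complexify ∘ Wr) volume := (hWrs.comp_clm complexify.toContinuousLinearMap).continuous.integrable_unitAddTorus
  have hcoefZ : ∀ m : ℤ × (Fin 3 → ℤ), mFourierCoeff (complexify ∘ WZ) (Fin.cons m.1 m.2) = (𝐜 (𝐰 kZ)) m := by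
    intro m
    have e : (complexify ∘ WZ) = (complexify ∘ We) + (l : ℂ) • (complexify ∘ Wr) := by
      funext y
      simp only [hWZ, Function.comp_apply, Pi.add_apply, Pi.smul_apply, map_add, LinearIsometry.map_smul, Complex.coe_smul]
    rw [e, mFourierCoeff_add hIe (hIr.smul (l : ℂ)), mFourierCoeff_const_smul, hcoefe m, hcoefr m, hcZ m]
  have hZ0 : ∀ n : ℤ, (𝐜 (𝐰 kZ)) (n, 0) = 0 := cw_zero_mode (W_zero hW kZ)
  have hZt : ∀ mm : ℤ × (Fin 3 → ℤ), (∑ jj : Fin 3, ((mm.2 jj : ℤ) : ℂ) * ((𝐜 (𝐰 kZ)) mm) jj) = 0 := cw_transversal (W_trans hW kZ)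
  have hZr : RapidDecay (𝐄 (𝐜 (𝐰 kZ))) := by
    have e : 𝐄 (𝐜 (𝐰 kZ)) = 𝐄 (𝐜 (𝐰 ke)) + (l : ℂ) • 𝐄 (𝐜 (𝐰 kr)) := by
      funext K
      simp only [Pi.add_apply, Pi.smul_apply]
      exact hcZ (K 0, Fin.tail K)
    rw [e]; exact hre.add (hrr.const_smul _)
  -- §b the second-order field of the combination and its unrolling
  obtain ⟨hHs, hH0', hHcoef⟩ := secondOrderField (Wr := WZ) hWZs hcoefZ hZ0 hZt hZr (μe + l * μr)
  set Hc : UnitAddTorus (Fin 4) → EuclideanSpace ℂ (Fin 3) := fun y => ((μe + l * μr : ℝ) : ℂ) • (complexify ∘ Torus.partialDeriv 0 WZ) y +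
      ∑ j : Fin 3, ((complexify ∘ WZ) y) j • Torus.partialDeriv (Fin.succ j) (complexify ∘ WZ) y with hHc
  have hunroll : ∀ t x, Hc (Fin.cons (((τ⁻¹ * t : ℝ)) : UnitAddCircle) x) =
      Torus.realToComplex (Torus.convect (Z t) (Z t) x - ((-(μe + l * μr)) * τ) • Torus.timeDerivWithin univ Z t x) := by
    intro t x
    have hs : τ * (τ⁻¹ * t) = t := by field_simp
    have h0 := partialDeriv_zero_timeRoll hzs hzper (τ⁻¹ * t) x
    rw [hroll, hs] at h0
    have hsl : timeSlice WZ (((τ⁻¹ * t : ℝ)) : UnitAddCircle) = Z t := by rw [← hroll, timeSlice_timeRoll hzper, hs]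
    have hconv : (∑ j : Fin 3, ((complexify ∘ WZ) (Fin.cons (((τ⁻¹ * t : ℝ)) : UnitAddCircle) x)) j •
        Torus.partialDeriv (Fin.succ j) (complexify ∘ WZ) (Fin.cons (((τ⁻¹ * t : ℝ)) : UnitAddCircle) x)) =
        complexify (Torus.convect (Z t) (Z t) x) := by
      rw [← hsl, convect_timeSlice (V := WZ) hWZs, map_sum]
      refine Finset.sum_congr rfl fun j _ => ?_
      have hd : Torus.partialDeriv (Fin.succ j) (complexify ∘ WZ) (Fin.cons (((τ⁻¹ * t : ℝ)) : UnitAddCircle) x) =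
          complexify (Torus.partialDeriv (Fin.succ j) WZ (Fin.cons (((τ⁻¹ * t : ℝ)) : UnitAddCircle) x)) := by
        have h1 := partialDeriv_clm_comp hWZs complexify.toContinuousLinearMap (Fin.succ j) (Fin.cons (((τ⁻¹ * t : ℝ)) : UnitAddCircle) x)
        simpa only [LinearIsometry.coe_toContinuousLinearMap] using h1
      rw [hd, Function.comp_apply, complexify_apply, Complex.coe_smul, LinearIsometry.map_smul]
    simp only [hHc]
    rw [hconv, Function.comp_apply, h0, LinearIsometry.map_smul, SteadyLattice.realToComplex_eq_complexify, map_sub,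
      LinearIsometry.map_smul, ← Complex.coe_smul τ, smul_smul, neg_mul, neg_smul, sub_neg_eq_add, add_comm]
    congr 1
    rw [← Complex.coe_smul, Complex.ofReal_mul]
  -- §c the full inhomogeneity as a smooth field on `T⁴`
  have hdU : IsSmooth (complexify ∘ Torus.partialDeriv 0 (timeRoll τ u)) := (hU.partialDeriv 0).comp_clm complexify.toContinuousLinearMap
  obtain ⟨hHz, hHt, -, -⟩ := fieldFamily_admissible (τ := τ) (Z := H) hH hHper hHdiv hH0
  have hVH : IsSmooth (complexify ∘ fun y => timeRoll τ H y - 0) :=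
    ((isSmooth_timeRoll hH hHper).sub (isSmooth_const _)).comp_clm complexify.toContinuousLinearMap
  set Gc : UnitAddTorus (Fin 4) → EuclideanSpace ℂ (Fin 3) := fun y =>
    ((βp : ℂ) * ((τ⁻¹ : ℝ) : ℂ)) • (complexify ∘ Torus.partialDeriv 0 (timeRoll τ u)) y + Hc y +
      (α : ℂ) • (complexify ∘ fun y => timeRoll τ H y - 0) y with hGc
  have hG1 : IsSmooth (fun y : UnitAddTorus (Fin 4) => ((βp : ℂ) * ((τ⁻¹ : ℝ) : ℂ)) • (complexify ∘ Torus.partialDeriv 0 (timeRoll τ u)) y) :=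
    isSmooth_smul_complex (isSmooth_const _) hdU
  have hG3 : IsSmooth (fun y : UnitAddTorus (Fin 4) => (α : ℂ) • (complexify ∘ fun y => timeRoll τ H y - 0) y) :=
    isSmooth_smul_complex (isSmooth_const _) hVH
  have hGcs : IsSmooth Gc := (hG1.add hHs).add hG3
  have hβ : (-μe) * τ + l * ((-μr) * τ) = (-(μe + l * μr)) * τ := by ring
  have hfun : (fun t x => (βp : ℂ) • velocityDot u t x + Torus.realToComplex (Torus.convect (Z t) (Z t) x -
      ((-μe) * τ + l * ((-μr) * τ)) • Torus.timeDerivWithin univ Z t x + α • H t x)) =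
      fun t : ℝ => fun x : UnitAddTorus (Fin 3) => Gc (Fin.cons (((τ⁻¹ * t : ℝ)) : UnitAddCircle) x) := by
    funext t x
    have hs : τ * (τ⁻¹ * t) = t := by field_simp
    have h0 := partialDeriv_zero_timeRoll hsol.smooth_velocity hper (τ⁻¹ * t) x
    rw [hs] at h0
    rw [hβ]
    simp only [hGc, Function.comp_apply, h0, hunroll t x, timeRoll_cons hHper, hs, sub_zero, LinearIsometry.map_smul, velocityDot,
      SteadyLattice.realToComplex_eq_complexify, map_add, map_sub]
    rw [← Complex.coe_smul τ, smul_smul, mul_assoc, ← Complex.ofReal_mul, inv_mul_cancel₀ hτ.ne', Complex.ofReal_one, mul_one,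
      ← Complex.coe_smul α]
    abel
  have hmem' : (fun t x => Torus.realToComplex (wp t x)) ∈
      linPeriodicSol ν u τ (fun t : ℝ => fun x : UnitAddTorus (Fin 3) => Gc (Fin.cons (((τ⁻¹ * t : ℝ)) : UnitAddCircle) x)) := by
    rw [← hfun]; exact hmem
  -- §d the right-hand side vector and its coefficients
  have hYQ : ∀ m : ℤ × (Fin 3 → ℤ), m.2 ≠ 0 →
      (𝐰 (((μe + l * μr) • Ds kZ + B kZ kZ : W))) m = Torus.lerayCoeff m.2 (mFourierCoeff Hc (Fin.cons m.1 m.2)) := by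
    intro m hm
    rw [hHcoef m, SteadyLattice.lerayCoeff_add', coeW_add, Pi.add_apply, coeW_smul, Pi.smul_apply, hDs, hBf,
      SteadyLattice.lerayCoeff_of_kdot_eq_zero hm (by
        rw [SteadyLattice.kdot_smul, SteadyLattice.kdot_smul, hZt m, mul_zero, mul_zero] :
        (∑ jj : Fin 3, ((m.2 jj : ℤ) : ℂ) * (((((μe + l * μr : ℝ)) : ℂ) • ((2 * Real.pi * Complex.I * (m.1 : ℂ)) • (𝐜 (𝐰 kZ)) m)) jj)) = 0)]
    congr 1
    rw [← Complex.coe_smul]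
    simp only [smul_smul]
    have hL : ((((Λ m)) : ℝ) : ℂ) ≠ 0 := by exact_mod_cast ne_of_gt (lt_of_lt_of_le one_pos (one_le_wt hm))
    congr 1
    rw [Complex.ofReal_inv]
  have hY : ∀ m : ℤ × (Fin 3 → ℤ), m.2 ≠ 0 →
      (𝐰 ((((βp * τ⁻¹) • Ds x₀ + ((μe + l * μr) • Ds kZ + B kZ kZ) + α • YH) : W))) m =
        Torus.lerayCoeff m.2 (mFourierCoeff Gc (Fin.cons m.1 m.2)) := by
    intro m hm
    have hint1 : Integrable (fun y : UnitAddTorus (Fin 4) => ((βp : ℂ) * ((τ⁻¹ : ℝ) : ℂ)) • (complexify ∘ Torus.partialDeriv 0 (timeRoll τ u)) y) volume :=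
      hG1.continuous.integrable_unitAddTorus
    have hint2 : Integrable Hc volume := hHs.continuous.integrable_unitAddTorus
    have hint3 : Integrable (fun y : UnitAddTorus (Fin 4) => ((α : ℂ) • (complexify ∘ fun y => timeRoll τ H y - 0) y : EuclideanSpace ℂ (Fin 3))) volume :=
      hG3.continuous.integrable_unitAddTorus
    have e1 : mFourierCoeff Gc (Fin.cons m.1 m.2) = ((βp : ℂ) * ((τ⁻¹ : ℝ) : ℂ)) • ((2 * Real.pi * Complex.I * (m.1 : ℂ)) • 𝐨[τ, u] m) +
        mFourierCoeff Hc (Fin.cons m.1 m.2) + (α : ℂ) • 𝐮[timeRoll τ H, 0] m := by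
      have e2 : Gc = ((fun y => ((βp : ℂ) * ((τ⁻¹ : ℝ) : ℂ)) • (complexify ∘ Torus.partialDeriv 0 (timeRoll τ u)) y) + Hc) +
          fun y : UnitAddTorus (Fin 4) => (α : ℂ) • (complexify ∘ fun y => timeRoll τ H y - 0) y := by funext y; simp [hGc]
      rw [e2, mFourierCoeff_add (hint1.add hint2) hint3, mFourierCoeff_add hint1 hint2,
        show (fun y => ((βp : ℂ) * ((τ⁻¹ : ℝ) : ℂ)) • (complexify ∘ Torus.partialDeriv 0 (timeRoll τ u)) y) =
          ((βp : ℂ) * ((τ⁻¹ : ℝ) : ℂ)) • (complexify ∘ Torus.partialDeriv 0 (timeRoll τ u)) from rfl, mFourierCoeff_const_smul,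
        coeff_partialDeriv_zero hU m,
        show (fun y => (α : ℂ) • (complexify ∘ fun y => timeRoll τ H y - 0) y) = (α : ℂ) • (complexify ∘ fun y => timeRoll τ H y - 0) from rfl,
        mFourierCoeff_const_smul]
    rw [e1, SteadyLattice.lerayCoeff_add', SteadyLattice.lerayCoeff_add', coeW_add, coeW_add, Pi.add_apply, Pi.add_apply,
      coe_smul_Ds_orbit hDs hsol hper hf0 x₀ hx₀ (βp * τ⁻¹) m, hYQ m hm, coeW_smul, Pi.smul_apply, hYH,
      SteadyLattice.lerayCoeff_of_kdot_eq_zero hm (by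
        rw [SteadyLattice.kdot_smul, SteadyLattice.kdot_smul, hut m, mul_zero, mul_zero] :
        (∑ jj : Fin 3, ((m.2 jj : ℤ) : ℂ) * ((((βp : ℂ) * ((τ⁻¹ : ℝ) : ℂ)) • ((2 * Real.pi * Complex.I * (m.1 : ℂ)) • 𝐨[τ, u] m)) jj)) = 0),
      SteadyLattice.lerayCoeff_of_kdot_eq_zero hm (by
        rw [SteadyLattice.kdot_smul, hHt m, mul_zero] :
        (∑ jj : Fin 3, ((m.2 jj : ℤ) : ℂ) * (((α : ℂ) • 𝐮[timeRoll τ H, 0] m) jj)) = 0), Complex.ofReal_mul, Complex.coe_smul]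
  obtain ⟨kp, -, hkp⟩ := vec_eq_of_classical hW hDs hL₀ hBf hτ hsol hper hf0 x₀ hx₀ hswp hwpper hwpdiv hwp0 hGcs hmem' _ hY
  exact ⟨kp, hkp⟩

end Transfer

/-! ## Registered part B (abstract, notation-free) -/

section Abstract

/-- **Registered sub-goal `lsSaddlePeriodic_partB`** (companion c3): a lattice RESPONSE `qd` (`T qd = frc d`) makes `d` invisible
(`ψ (frc d) = 0`), and the derivative of the family along `(d, x)` runs through the line `−qd + ℝ gh`. [folklore] -/
theorem lsSaddlePeriodic_partB : ∀ (X Y P : Type) [NormedAddCommGroup X] [NormedSpace ℝ X] [NormedAddCommGroup Y] [NormedSpace ℝ Y] [NormedAddCommGroup P] [NormedSpace ℝ P] (T : X →L[ℝ] Y) (frc : P →L[ℝ] Y) (e : Y) (ψ : Y →L[ℝ] ℝ) (φ₂ : X →L[ℝ] ℝ) (ℓ : P × ℝ →L[ℝ] ℝ) (Dυ : P × ℝ →L[ℝ] X) (gh qd : X) (d : P), (∀ w : X, ψ (T w) = 0) → ψ e = 1 → (∀ q : X, T q = 0 → ∃ z : ℝ, q = z • gh) → φ₂ gh ≠ 0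 → (∀ (d' : P) (x : ℝ), T (Dυ (d', x)) + frc d' = ℓ (d', x) • e ∧ φ₂ (Dυ (d', x)) = x) → T qd = frc d → ψ (frc d) = 0 ∧ ∀ z : ℝ, Dυ (d, z * φ₂ gh - φ₂ qd) = -qd + z • gh := by
  intro X Y P _ _ _ _ _ _ T frc e ψ φ₂ ℓ Dυ gh qd d hψT hψe hker hφ₂ hder hqd
  have hd0 : ψ (frc d) = 0 := by rw [← hqd]; exact hψT qd
  refine ⟨hd0, fun z => ?_⟩
  obtain ⟨h1, h2⟩ := hder d (z * φ₂ gh - φ₂ qd)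
  have hℓ : ℓ (d, z * φ₂ gh - φ₂ qd) = 0 := by
    have h3 := congrArg ψ h1
    rw [map_add, hψT, hd0, add_zero, map_smul, hψe, smul_eq_mul, mul_one] at h3
    exact h3.symm
  rw [hℓ, zero_smul, ← hqd] at h1
  have h1' : T (Dυ (d, z * φ₂ gh - φ₂ qd) + qd) = 0 := by rw [map_add]; exact h1
  obtain ⟨z', hz'⟩ := hker _ h1'
  have hz : z' = z := by
    have h4 := congrArg φ₂ hz'
    rw [map_add, h2, map_smul, smul_eq_mul] at h4
    have h5 : (z' - z) * φ₂ gh = 0 := by linarith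
    rcases mul_eq_zero.1 h5 with h6 | h6
    · linarith
    · exact absurd h6 hφ₂
  rw [hz] at hz'
  rw [eq_sub_of_add_eq hz']
  abel

end Abstract

end Summit.AnomalousDissipation.AnomalousDissipation.Theorems.RobustLoudUpgrade.LsFamilyPeriodic

end
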